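import Summits.QuantumAdvantage.QuantumAdvantage.Theses.RingFrame
import Summits.QuantumAdvantage.QuantumAdvantage.Theorems.RingFrameBridge
import Summits.QuantumAdvantage.QuantumAdvantage.Theorems.RingFrameBeta
import Summits.QuantumAdvantage.QuantumAdvantage.Theorems.RingFrameRingToElimTube
import HarnessLib

/-!
# Rung F-Q1 CLOSED: `AdviceFreeQNC0` — advice-free `QNC⁰ ⊄ FAC⁰[2]/rpoly` for the 2D Hidden Linear Function problem

Cell qa-qnc0, route RingFrame (rung F-Q1 of summit QuantumAdvantage, D-0059/D-0061; deciding theorem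
`Summit.QuantumAdvantage.QuantumAdvantage.Theses.RingFrame.closes`).  All seven items of the route are closed
`proved` on the ledger (β `LowDegAvoidOfRobustHegedus` p415978, `RobustHegedusFact`, `ElimSqrtOfSparse`,
`ElimHardOfSqrt`, `BridgeRingToSep`; crux α `RingToElim` by qa-qnc0-prover g9's `Theorems.ringToElim_tube`
(p556914, the tube bound, ROUND-11 of planner qa-qnc0-p2); aside `RingHardLogDeg` by qn-prover-3 g7).  This file is
the 10-line CERTIFICATE (planner qa-qnc0-p2 g12's draft `line12/land/RungF1Closed.lean`, verbatim): the rung leaf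

  `Summit.QuantumAdvantage.AdviceFreeQNC0.AdviceFreeQNC0 := AdviceFreeQNC0Sep 2`

— some relation family with polynomially bounded input length (BGK's 2D HLF, `hlfFamily`) is solved with certainty by
advice-free `QNC⁰` circuits and is hard (one gap `θ < 1`, every depth, every polynomial size) for `FAC⁰[2]` circuit
tuples with uniformly random shared bits — obtained by applying `RingFrame.closes` to the six landed item proofs.

WHAT THIS IS NOT: not the summit `QuantumAdvantage` (BQP ≠ BPP) — this is the rung leaf F-Q1 (Grewal–Kumar 2024 /
WKST 2019 printed-open advice-free separation for `p = 2`, constant gap); the exponential-size and `GC⁰(k)[2]`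
strengthenings are `AdviceFreeQNC0/ExpRungClosed.lean` and `AdviceFreeQNC0/GCBridge.lean`.
-/

namespace Summit.QuantumAdvantage.AdviceFreeQNC0

open Summit.QuantumAdvantage.QuantumAdvantage

/-- **Rung F-Q1 — PROVED**: advice-free `QNC⁰ ⊄ FAC⁰[2]/rpoly` (the leaf `AdviceFreeQNC0 = AdviceFreeQNC0Sep 2`),
by route RingFrame's deciding theorem `closes` applied to the six proved items. -/
theorem adviceFreeQNC0 : AdviceFreeQNC0 :=
  Theses.RingFrame.closes Theorems.ringToElim_tube Theorems.ringFrame_lowDegAvoidOfRobustHegedus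
    Theorems.ringFrame_robustHegedusFact Theses.RingFrame.ElimSqrtOfSparse_holds
    Theses.RingFrame.ElimHardOfSqrt_holds Theorems.bridgeRingToSep_proof

end Summit.QuantumAdvantage.AdviceFreeQNC0
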